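import Mathlib.Analysis.Complex.Basic
import Mathlib.LinearAlgebra.Complex.FiniteDimensional
import Mathlib.LinearAlgebra.Determinant
import Mathlib.Topology.Algebra.Module.Determinant

/-!
# `T4Continuum.ShellMeasureRealFormDet` — [folklore] REAL FORMS OF A COMPLEX SPACE WITH A CONJUGATION: a real basis
# of the real form is a complex basis, `dim_ℝ E = dim_ℂ 𝒴`, and the complex determinant of a conjugation-commuting
# operator IS the real determinant of the operator read on the real form
(cell `pub-balaban`, sub-cell `t4`, spine estimate NE7c (node U5b); NE7c ROUND-2 crew seat
`b2b-balaban-t4-ne7c-formalise-leaf-02` gen 6 — idle-seat OFFER in the (LR)_j ∕ LZ orbit (journal `CLAIMS.log`,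
«THE JACOBIAN OF PRINT'S LINEARIZING SUBSTITUTION, READ ON THE REAL FORM»), file 1 of 2: the linear algebra consumed
by `ShellMeasureLinearizedJacobian`; ADDITIVE — imports Mathlib only, modifies nothing; [folklore]; 0 `def`,
0 `def … : Prop`, 0 sorry, 0 citations)

HONEST FRAMING.  Finite four-torus programme, rung (B)+1 only — NOT infinite volume, NOT a mass gap, NOT the Clay
problem, NOT summit progress; (B), `BetaPertHyp`, (B^μ) not consumed.  NE7c (`T4IndicatorShell.ShellWeightBound`) is
NOT PRINTED and NOT PROVED; «NE7c ⇐ the named binders» (trigger c3).  This file is pure [folklore] linear algebra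
(standard-API helper lemmas with no mathematical content of the cell's own); nothing of [Balaban 1983–89] enters.
HONEST DEPENDENCY (cell, verbatim): continuum YM on T⁴ ⇐ BetaPertH ∧ nine spine estimates (0/9 proved); BetaPertH ⇐
(D1) ∧ (D4) ∧ CAP+tail; G-an2-4 gates asym, D1 and NE2/3/4.

THE SETTING (hypothesis-style, the binder names of `ShellMeasureLinearizedRealForm` + ONE more).  `𝒴` a complex
normed space with a CONJUGATION `κY : 𝒴 ≃ₗᵢ⋆[ℂ] 𝒴` (`hκY : κY (κY B) = B` — `B12JacobianReal267`'s typing of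
print's «𝐠-valued» real structure), and a REAL FORM: a real normed space `E` with continuous real-linear
`ιE : E →L[ℝ] 𝒴`, `πE : 𝒴 →L[ℝ] E` such that `ιE` is real-valued (`hιEr : κY (ιE y) = ιE y`), `ιE ∘ πE = id` on
real vectors (`hιπE : κY B = B → ιE (πE B) = B`) and — the one axiom this file adds — `πE ∘ ιE = id`
(`hπιE : πE (ιE y) = y`, injectivity of the real form; the canonical real form `E := Fix κY`, `πE := ½(1 + κY)` has
it).  CONTENTS: §1 `ιE` is TOTALLY REAL (`ιE u + I • ιE w = 0 ⇒ u = w = 0`) and, with `πE`, SPANNING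
(`B = ½(B + κB) + ½(B − κB)`), so a real basis of `E` is a complex basis of `𝒴` (`exists_basis_realForm`) and
`dim_ℝ E = dim_ℂ 𝒴` (`finrank_realForm`); §2 for a continuous complex-linear `T` COMMUTING WITH `κY` the matrix of
`T` in that basis is the (real) matrix of `πE ∘ T↾ℝ ∘ ιE`, hence **`det_ℂ T = det_ℝ (πE ∘L T↾ℝ ∘L ιE)`**
(`det_realForm`, `det_realForm_re`).  (Compare `B12JacobianReal267` §1, which proves `det_ℂ T` REAL by a conjugate
basis; here the real form identifies it with a real determinant — the form Mathlib's change of variables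
`lintegral_image_eq_lintegral_abs_det_fderiv_mul` consumes in S33 `ShellMeasureLinearizedChart`.)  NOT an instance of
SM-L1…L6; NOTHING in the countdown moves; NE7c NOT PROVED; spine PROVED 0/9.
-/

noncomputable section

open Set

namespace Summit.QuantumFields.BalabanUV.T4Continuum.ShellMeasureRealFormDet

/-! ## §1 The real form is totally real and spanning: a real basis of `E` is a complex basis of `𝒴` -/

section RealForm

variable {𝒴 : Type*} [NormedAddCommGroup 𝒴] [NormedSpace ℂ 𝒴]
  {E : Type*} [NormedAddCommGroup E] [NormedSpace ℝ E]
  {κY : 𝒴 ≃ₗᵢ⋆[ℂ] 𝒴} {ιE : E →L[ℝ] 𝒴} {πE : 𝒴 →L[ℝ] E}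

omit [NormedSpace ℝ E] in
/-- a complex multiple splits into its real and imaginary parts: `c • x = (Re c) • x + I • ((Im c) • x)`. [folklore] -/
theorem smul_eq_re_add_I_smul_im (c : ℂ) (x : 𝒴) :
    c • x = (c.re : ℝ) • x + Complex.I • ((c.im : ℝ) • x) := by
  rw [← Complex.coe_smul, ← Complex.coe_smul, ← mul_smul, ← add_smul]
  congr 1
  rw [mul_comm]
  exact (Complex.re_add_im c).symm

/-- a conjugation is `I`-ANTIlinear: `κ (I • x) = −(I • κ x)`. [folklore] -/
theorem conj_I_smul (x : 𝒴) : κY (Complex.I • x) = -(Complex.I • κY x) := by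
  rw [κY.map_smulₛₗ, Complex.conj_I, neg_smul]

/-- **THE REAL FORM IS TOTALLY REAL**: `ιE u + I • ιE w = 0` forces `u = 0` and `w = 0` (apply `κ`: then also
`ιE u − I • ιE w = 0`). [folklore] -/
theorem totallyReal (hιEr : ∀ y, κY (ιE y) = ιE y) (hπιE : ∀ y, πE (ιE y) = y) {u w : E}
    (h : ιE u + Complex.I • ιE w = 0) : u = 0 ∧ w = 0 := by
  have h2 : ιE u - Complex.I • ιE w = 0 := by
    have e := congrArg κY h
    rw [map_add, conj_I_smul, hιEr, hιEr, map_zero, ← sub_eq_add_neg] at e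
    exact e
  have e1 : ιE u = -(Complex.I • ιE w) := eq_neg_of_add_eq_zero_left h
  have e2 : ιE u = Complex.I • ιE w := sub_eq_zero.mp h2
  have hw' : Complex.I • ιE w = 0 := by
    have e3 : (2 : ℂ) • (Complex.I • ιE w) = 0 := by
      rw [two_smul]
      nth_rewrite 1 [← e2]
      rw [e1, neg_add_cancel]
    rcases smul_eq_zero.mp e3 with h0 | h0
    · norm_num at h0
    · exact h0
  have hιw : ιE w = 0 := by
    rcases smul_eq_zero.mp hw' with h0 | h0
    · exact absurd h0 Complex.I_ne_zero
    · exact h0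
  have hιu : ιE u = 0 := by rw [e2, hιw, smul_zero]
  refine ⟨?_, ?_⟩
  · rw [← hπιE u, hιu, map_zero]
  · rw [← hπιE w, hιw, map_zero]

/-- **A REAL BASIS OF `E` IS `ℂ`-LINEARLY INDEPENDENT IN `𝒴`.** [folklore] -/
theorem linearIndependent_realForm (hιEr : ∀ y, κY (ιE y) = ιE y) (hπιE : ∀ y, πE (ιE y) = y)
    {n : ℕ} (bE : Module.Basis (Fin n) ℝ E) : LinearIndependent ℂ (fun i => ιE (bE i)) := by
  rw [Fintype.linearIndependent_iff]
  intro g hg i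
  have hsum : ∑ j, g j • ιE (bE j) =
      ιE (∑ j, (g j).re • bE j) + Complex.I • ιE (∑ j, (g j).im • bE j) := by
    rw [map_sum, map_sum, Finset.smul_sum, ← Finset.sum_add_distrib]
    refine Finset.sum_congr rfl fun j _ => ?_
    rw [map_smul, map_smul, smul_eq_re_add_I_smul_im]
  rw [hsum] at hg
  obtain ⟨hu, hw⟩ := totallyReal hιEr hπιE hg
  have hre := Fintype.linearIndependent_iff.mp bE.linearIndependent (fun j => (g j).re) hu i
  have him := Fintype.linearIndependent_iff.mp bE.linearIndependent (fun j => (g j).im) hw i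
  exact Complex.ext (by simpa using hre) (by simpa using him)

/-- every REAL vector (`κ B = B`) is a real combination of the real basis, hence in its complex span. [folklore] -/
theorem mem_span_realForm_of_fixed (hιπE : ∀ B, κY B = B → ιE (πE B) = B) {n : ℕ}
    (bE : Module.Basis (Fin n) ℝ E) {B : 𝒴} (hB : κY B = B) :
    B ∈ Submodule.span ℂ (Set.range fun i => ιE (bE i)) := by
  rw [← hιπE B hB, ← bE.sum_repr (πE B), map_sum]
  refine Submodule.sum_mem _ fun i _ => ?_
  rw [map_smul]
  exact Submodule.smul_of_tower_mem _ _ (Submodule.subset_span ⟨i, rfl⟩)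

/-- **A REAL BASIS OF `E` SPANS `𝒴` OVER `ℂ`**: `B = ½(B + κB) + ½(B − κB)` with `B + κB` and `I • (B − κB)`-type
vectors real. [folklore] -/
theorem span_realForm_eq_top (hκY : ∀ B, κY (κY B) = B) (hιπE : ∀ B, κY B = B → ιE (πE B) = B) {n : ℕ}
    (bE : Module.Basis (Fin n) ℝ E) : ⊤ ≤ Submodule.span ℂ (Set.range fun i => ιE (bE i)) := by
  intro B _
  set S := Submodule.span ℂ (Set.range fun i => ιE (bE i))
  have hR : ∀ C : 𝒴, C + κY C ∈ S := fun C =>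
    mem_span_realForm_of_fixed hιπE bE (by rw [map_add, hκY, add_comm])
  have h1 := hR B
  have h2 : Complex.I • (Complex.I • B + κY (Complex.I • B)) ∈ S := S.smul_mem _ (hR (Complex.I • B))
  have e : Complex.I • (Complex.I • B + κY (Complex.I • B)) = -B + κY B := by
    rw [conj_I_smul, smul_add, smul_neg, smul_smul, smul_smul, Complex.I_mul_I, neg_one_smul, neg_one_smul,
      neg_neg]
  rw [e] at h2
  have h3 : (B + κY B) - (-B + κY B) ∈ S := S.sub_mem h1 h2
  have e2 : (B + κY B) - (-B + κY B) = (2 : ℂ) • B := by rw [two_smul]; abel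
  rw [e2] at h3
  have h4 := S.smul_mem ((2 : ℂ)⁻¹) h3
  rwa [smul_smul, inv_mul_cancel₀ two_ne_zero, one_smul] at h4

/-- **THE REAL BASIS AS A COMPLEX BASIS.** [folklore] -/
theorem exists_basis_realForm (hκY : ∀ B, κY (κY B) = B) (hιπE : ∀ B, κY B = B → ιE (πE B) = B)
    (hιEr : ∀ y, κY (ιE y) = ιE y) (hπιE : ∀ y, πE (ιE y) = y) {n : ℕ} (bE : Module.Basis (Fin n) ℝ E) :
    ∃ bY : Module.Basis (Fin n) ℂ 𝒴, ∀ i, bY i = ιE (bE i) :=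
  ⟨Module.Basis.mk (linearIndependent_realForm hιEr hπιE bE) (span_realForm_eq_top hκY hιπE bE),
    fun i => Module.Basis.mk_apply _ _ i⟩

/-- the real form is injective. [folklore] -/
theorem injective_realForm (hπιE : ∀ y, πE (ιE y) = y) : Function.Injective ιE :=
  fun a b hab => by simpa [hπιE] using congrArg πE hab

/-- **`dim_ℝ E = dim_ℂ 𝒴`.** [folklore] -/
theorem finrank_realForm [FiniteDimensional ℂ 𝒴] (hκY : ∀ B, κY (κY B) = B)
    (hιπE : ∀ B, κY B = B → ιE (πE B) = B) (hιEr : ∀ y, κY (ιE y) = ιE y) (hπιE : ∀ y, πE (ιE y) = y) :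
    Module.finrank ℝ E = Module.finrank ℂ 𝒴 := by
  haveI : FiniteDimensional ℝ E :=
    FiniteDimensional.of_injective (ιE : E →ₗ[ℝ] 𝒴) (fun a b hab => by simpa [hπιE] using congrArg πE hab)
  obtain ⟨bY, -⟩ := exists_basis_realForm hκY hιπE hιEr hπιE (Module.finBasis ℝ E)
  rw [Module.finrank_eq_card_basis bY, Fintype.card_fin]

/-! ## §2 The determinant of a conjugation-commuting operator read on the real form -/

/-- **THE DETERMINANT READ ON THE REAL FORM.**  For a conjugation `κ` of a finite-dimensional complex space `𝒴`, a
real form `(ιE, πE)` (`ιE` real-valued, `ιE ∘ πE = id` on real vectors, `πE ∘ ιE = id`) and a complex-linear `T`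
COMMUTING WITH `κ`: the complex determinant of `T` IS the real determinant of the real operator `πE ∘ T ∘ ιE` (in the
real basis, which is a complex basis, `T` has a real matrix). [folklore] -/
theorem det_realForm [FiniteDimensional ℂ 𝒴] (hκY : ∀ B, κY (κY B) = B)
    (hιπE : ∀ B, κY B = B → ιE (πE B) = B) (hιEr : ∀ y, κY (ιE y) = ιE y) (hπιE : ∀ y, πE (ιE y) = y)
    (T : 𝒴 →L[ℂ] 𝒴) (hT : ∀ v, T (κY v) = κY (T v)) :
    (((πE ∘L T.restrictScalars ℝ ∘L ιE).det : ℝ) : ℂ) = LinearMap.det (T : 𝒴 →ₗ[ℂ] 𝒴) := by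
  classical
  haveI : FiniteDimensional ℝ E :=
    FiniteDimensional.of_injective (ιE : E →ₗ[ℝ] 𝒴) (fun a b hab => by simpa [hπιE] using congrArg πE hab)
  set bE := Module.finBasis ℝ E
  obtain ⟨bY, hbY⟩ := exists_basis_realForm hκY hιπE hιEr hπιE bE
  set Tℝ : E →L[ℝ] E := πE ∘L T.restrictScalars ℝ ∘L ιE with hTℝ
  have hcol : ∀ j, T (bY j) = ∑ i, ((bE.repr (Tℝ (bE j)) i : ℝ) : ℂ) • bY i := by
    intro j
    have hfixj : κY (T (bY j)) = T (bY j) := by rw [hbY, ← hT, hιEr]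
    have h1 : T (bY j) = ιE (Tℝ (bE j)) := by
      rw [hTℝ]
      simp only [ContinuousLinearMap.coe_comp, Function.comp_apply, ContinuousLinearMap.coe_restrictScalars']
      rw [← hbY, hιπE _ hfixj]
    rw [h1]
    conv_lhs => rw [← bE.sum_repr (Tℝ (bE j))]
    rw [map_sum]
    exact Finset.sum_congr rfl fun i _ => by rw [map_smul, hbY i, Complex.coe_smul]
  have hmat : LinearMap.toMatrix bY bY (T : 𝒴 →ₗ[ℂ] 𝒴) =
      (algebraMap ℝ ℂ).mapMatrix (LinearMap.toMatrix bE bE (Tℝ : E →ₗ[ℝ] E)) := by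
    ext i j
    simp only [RingHom.mapMatrix_apply, Matrix.map_apply, LinearMap.toMatrix_apply, ContinuousLinearMap.coe_coe]
    rw [hcol j, congrFun (bY.repr_sum_self _) i]
    rfl
  rw [← LinearMap.det_toMatrix bY, hmat, ← RingHom.map_det, LinearMap.det_toMatrix bE]
  rfl

/-- … real-part form: `det_ℝ (πE ∘ T ∘ ιE) = Re det_ℂ T`. [folklore] -/
theorem det_realForm_re [FiniteDimensional ℂ 𝒴] (hκY : ∀ B, κY (κY B) = B)
    (hιπE : ∀ B, κY B = B → ιE (πE B) = B) (hιEr : ∀ y, κY (ιE y) = ιE y) (hπιE : ∀ y, πE (ιE y) = y)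
    (T : 𝒴 →L[ℂ] 𝒴) (hT : ∀ v, T (κY v) = κY (T v)) :
    (πE ∘L T.restrictScalars ℝ ∘L ιE).det = (LinearMap.det (T : 𝒴 →ₗ[ℂ] 𝒴)).re := by
  rw [← det_realForm hκY hιπE hιEr hπιE T hT, Complex.ofReal_re]

end RealForm

end Summit.QuantumFields.BalabanUV.T4Continuum.ShellMeasureRealFormDet

end
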